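import Summits.BirchSwinnertonDyer.Rank1Residual.SmallImageMu.MuDefectLeFineMuEdges
import Summits.BirchSwinnertonDyer.BirchSwinnertonDyer.Theses.OneSidedTwistSqueezeX9
import HarnessLib

set_option autoImplicit false

-- the summit and its single problem are both named `BirchSwinnertonDyer` (registry layout D-0017)
set_option linter.dupNamespace false

/-!
# Route `OneSidedTwistSqueezeX9`, crux `KatoDivisibilityX9` (stmt-BirchSwinnertonDyer-20547):
# the registered stubs `stub_wuthrichUpgradeX9` and `stub_fmwRungX9` of LINE A v2 CLOSED BY NAME AND SIGNATURE

Cell `bsd-f3-mu`, ES lens (planner-bsd-f3-mu-es g8; MEMO-es §28–§29).  Landing target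
`Summits/BirchSwinnertonDyer/BirchSwinnertonDyer/Theorems/OneSidedTwistSqueezeX9KatoDivisibilityX9StubsOfF1.lean`,
`--supports stmt-BirchSwinnertonDyer-20547`.  Tree imports only; no new named facts; nothing asserted; 0 sorry.
THIN VERSION (v2): the per-pair engines are CITED from the landed `SmallImageMu/MuDefectLeFineMuEdges.lean`
(p571056, typer seat -ty g2, from the es g7 landing twin): `SmallImageMu.katoDivisibilityOnClassX9_of_conjAOnClassX9_F1`
(Conjecture A on X9 ⟹ the node, modulo F1 alone: per package `μ(Y) ≤ μ(𝐇¹/K.Z)` ⟹ `G₁ ∈ char X`, Kato's Thm. 17.4 (3)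
argument with the `(p)`-part input replaced, off `(p)` the image-free Euler-system bound; fine `μ = 0` from (A) by
`Rank1Residual.ConjAAt.fineMuZeroAt`) and `SmallImageMu.katoDivisibilityAt_of_rankOneAnchorData_F1` (the FMW rung).

THE REGISTERED SKELETON (LINE A v2, `Cruxes/KatoDivisibilityX9/Lines/birth.lean`, -imc g7, sha16 61050dcd80bda0fb,
namespace `…Cruxes.KatoDivisibilityX9.Birth`): `stub_katoPackageF1 : Kato2004.exists_divisibilityInputs_fineQuotient`
(F1, cite-only) · `stub_conjAOnClassX9 : ConjAOnClassX9` (OPEN) · `stub_wuthrichUpgradeX9` · `stub_fmwRungX9` ·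
`KatoDivisibilityX9_of := stub_wuthrichUpgradeX9 stub_katoPackageF1 stub_conjAOnClassX9`.  THIS FILE proves stubs 2 and 4
with exactly those names and registered texts (same `open`s as the skeleton; the route decl `KatoDivisibilityX9` is the node
`SmallImageMu.KatoDivisibilityOnClassX9` by `rfl`).  After it LINE A = «`stub_conjAOnClassX9` (Conjecture A on X9, OPEN,
the whole difficulty) + `stub_katoPackageF1` (F1, refereed print)»; the crux itself is NOT closed (X9: 790 = 130 5Ns + 36 7Ns
+ 624 5S4 pairs, none decided here).  Beyond-print theorem: NO.

References: K. Kato, Astérisque 295 (2004), Thm. 17.4 (p. 273), §17.13 (pp. 279–280) [Kato2004Asterisque];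
C. Wuthrich, J. London Math. Soc. (2) 70 (2004), Thm. 2 / Lemma 3; JAG 16 (2007) [Wuthrich2006]; J. Coates, R. Sujatha,
Math. Ann. 331 (2005), §3 Conjecture A [CoatesSujatha2005]; R. Greenberg, LNM 1716 (1999), Prop. 3.8 [GreenbergLNM1716].
-/

noncomputable section

open WeierstrassCurve Literature.NumberTheory.EllipticCurves Literature.NumberTheory.EllipticCurves.ModularForms
  Summit.BirchSwinnertonDyer.BirchSwinnertonDyer.Rank1Residual
open Literature.NumberTheory.EllipticCurves.Rank1Residual (RankOneAnchorDataAt KatoDivisibilityAt MuDefectLeFineMuAt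
  ConjAAt)
open Summit.BirchSwinnertonDyer.Rank1Residual.SmallImageMu (ConjAOnClassX9 KatoDivisibilityOnClassX9
  katoDivisibilityOnClassX9_of_conjAOnClassX9_F1 katoDivisibilityAt_of_rankOneAnchorData_F1)
open Summit.BirchSwinnertonDyer.BirchSwinnertonDyer.Theses.OneSidedTwistSqueezeX9 (KatoDivisibilityX9)

namespace Summit.BirchSwinnertonDyer.BirchSwinnertonDyer.Theorems.OneSidedTwistSqueezeX9KatoDivisibilityX9Stubs

/-- The route decl IS the tree node. -/
example : KatoDivisibilityX9 = KatoDivisibilityOnClassX9 := rfl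

/-- **STUB 2 of `Cruxes/KatoDivisibilityX9/Lines/birth.lean` (v2), closed**: F1 → Conjecture A on X9 → the crux
(`SmallImageMu.katoDivisibilityOnClassX9_of_conjAOnClassX9_F1`, landed p571056).
[cite: Wuthrich2006, Thm. 2 and Lemma 3 (p. 717)] [cite: Kato2004Asterisque, Thm. 17.4 (p. 273), §17.13 (pp. 279–280)] -/
theorem stub_wuthrichUpgradeX9 :
    Kato2004.exists_divisibilityInputs_fineQuotient → ConjAOnClassX9 → KatoDivisibilityX9 :=
  fun hF1 hA => katoDivisibilityOnClassX9_of_conjAOnClassX9_F1 hF1 hA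

/-- **STUB 4 of `Cruxes/KatoDivisibilityX9/Lines/birth.lean` (v2), closed**: F1 → the FMW rung at every anchored X9 pair
(`SmallImageMu.katoDivisibilityAt_of_rankOneAnchorData_F1`, landed p571056; the BC5 witness regime, e.g. `648a1 @ p = 5`, 5S4).
[cite: GreenbergLNM1716, Prop. 3.8 (pp. 95–96)] [cite: Kato2004Asterisque, Thm. 17.4 (p. 273) and §17.13] -/
theorem stub_fmwRungX9 :
    Kato2004.exists_divisibilityInputs_fineQuotient →
    ∀ (W : WeierstrassCurve ℚ) [W.IsElliptic] [W.IsGloballyMinimal] (p : ℕ) [Fact p.Prime],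
      ClassX9 W p → RankOneAnchorDataAt W p → KatoDivisibilityAt W p :=
  fun hF1 _W _ _ _p _ hX9 hdata => katoDivisibilityAt_of_rankOneAnchorData_F1 hF1 hX9 hdata

/-- **What is left of LINE A** (kernel reading of `KatoDivisibilityX9_of`): the crux follows from Conjecture A on X9
and F1, and from nothing else. [folklore] -/
theorem katoDivisibilityX9_of_stubs (hF1 : Kato2004.exists_divisibilityInputs_fineQuotient) (hA : ConjAOnClassX9) :
    KatoDivisibilityX9 :=
  stub_wuthrichUpgradeX9 hF1 hA

end Summit.BirchSwinnertonDyer.BirchSwinnertonDyer.Theorems.OneSidedTwistSqueezeX9KatoDivisibilityX9Stubs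

end
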